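import Literature.NumberTheory.Irrationality.LaiYu2020.AnalysisLemmaRatio
import Literature.NumberTheory.Irrationality.LaiYu2020.RootAsymptotics
import Literature.NumberTheory.Irrationality.LaiYu2020.Elimination
import HarnessLib

/-!
# Lai–Yu 2020, Theorem 1.1: the discharge `theorem11_holds`

Topic `Literature/NumberTheory/Irrationality/LaiYu2020`, namespace
`Literature.NumberTheory.Irrationality.LaiYu2020` (helpers in `Lemma41`). Source: L. Lai, P. Yu, *A note on the
number of irrational odd zeta values*, Compositio Math. 156 (2020) 1699–1717, arXiv:1911.08458, §5 "Proof of
Theorem 1.1" (p. 10 of the arXiv version) [LaiYu2020].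

Printed proof (§5): "`r₀` is the maximum point of `r ↦ ((r+1) log(r+1) − r log r − 1)/(2r+1)` with maximal
value `1 − log r₀`. Take `r` (rational) sufficiently close to `r₀` and `c` close to `c₀/A` such that
`(A/4)(2r+1)c² + r log r − (r+1) log(r+1) < −1`; by Proposition 4.2, `g(x₀) < exp(−(s+1))` for large `s`
(`B = c√s/√(log s)`); `|Ψ_B| = (A + o(1))B = o(s)`; by Proposition 5.1 the number of irrationals in
`{ζ(3), …, ζ(s)}` is at least `|Ψ_B| = (Ac + o(1)) √s/√(log s) ≥ (c₀ − ε)√s/√(log s)`."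

This file PROVES Theorem 1.1 (`theorem11_holds : theorem11`, the named fact of
`NumberOfIrrationalOddZetaValues.lean`) along these lines, assembling the sibling files:
* `tendsto_lcm_pow_mul_rT` — the decay `d_{n+1}^{s+1} r_{n,θ} → 0` from `Λ(x₀) ≤ −(1+κ)(s+1)`
  (`AnalysisLemmaLimit.rT_le_exp`, the prime number theorem `log d_N/N → 1`);
* `r₀_mul_succ`, `phitilde_r₀`, `c₀_sq` — `r₀(r₀+1) = e²`, `φ̃(r₀) = (2r₀+1)(1 − log r₀)`, `c₀² = 4A(1 − log r₀)`;
* `exists_rat_gap` — a rational `r = u/v` (`v` even) near `r₀` with `(2r+1) c₁²/(4A) < φ̃(r)` for any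
  `0 ≤ c₁ < c₀` (continuity of `r ↦ 4Aφ̃(r)/(2r+1)` at `r₀`);
* `eventually_card_le_of_gap` — for admissible `(r, c)`: `|Ψ_{B(s)}| ≤ #{odd i ∈ [3,s] : ζ(i) ∉ ℚ}` for all large
  odd `s` (Prop. 4.2 (1): `exists_root`; Prop. 4.2 (2): `eventually_Lam_le`; Lemma 4.1: `tendsto_ratio`; §5:
  `card_denominatorSet_le_card_irrational_of_decay`);
* `theorem11_holds` — with `c = (c₀ − ε/2)/A` and Prop. 2.2 (1) (`card_denominatorSet_holds`: `|Ψ_B| ∼ AB`).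
Conventions: `r = u/v` with `v` even (so that `n = vm` is even), `A = density = ζ(2)ζ(3)/ζ(6)`
(`density_eq_zetaValue`). WHAT THIS IS NOT: nothing here bears on `ζ(5)` (cell zeta5-irr, rung F-Z1): the
theorem counts irrational values among `ζ(3), …, ζ(s)` for LARGE `s`.
-/

open Finset Filter
open scoped Topology

namespace Literature.NumberTheory.Irrationality.LaiYu2020

open Literature.NumberTheory.Transcendental (zetaValue tendsto_log_lcmUpto_div)
open Literature.NumberTheory.Multiplicative.TotientValueCounting (density density_pos)

namespace Lemma41

/-! ### The decay `d_{n+1}^{s+1} r_{n,θ} → 0` -/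

/-- `d_{vm+1} ≤ e^{(1+η)(vm+1)}` for all large `m` (prime number theorem, `log d_N ∼ N`).
[cite: LaiYu2020, §3 ("d_m = lcm[1,…,m]") and §5 (proof of Prop. 5.1, "d_{n+1}^{s+1} = e^{(1+o(1))(s+1)n}")] -/
theorem eventually_lcmUpto_le_exp {v : ℕ} (hv : 1 ≤ v) {η : ℝ} (hη : 0 < η) :
    ∀ᶠ m : ℕ in atTop, (Nat.lcmUpto (v * m + 1) : ℝ) ≤ Real.exp ((1 + η) * (((v * m : ℕ) : ℝ) + 1)) := by
  have hmul : Tendsto (fun m : ℕ => v * m + 1) atTop atTop :=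
    tendsto_atTop_mono (fun m => show m ≤ v * m + 1 by nlinarith) tendsto_id
  have h := (tendsto_log_lcmUpto_div.comp hmul).eventually_lt_const (show (1 : ℝ) < 1 + η by linarith)
  filter_upwards [h] with m hm
  simp only [Function.comp_apply] at hm
  have hpos : (0 : ℝ) < Nat.lcmUpto (v * m + 1) := by exact_mod_cast Nat.lcmUpto_pos _
  have hN : (0 : ℝ) < ((v * m + 1 : ℕ) : ℝ) := by positivity
  rw [div_lt_iff₀ hN] at hm
  push_cast at hm ⊢
  calc (Nat.lcmUpto (v * m + 1) : ℝ) = Real.exp (Real.log (Nat.lcmUpto (v * m + 1))) := (Real.exp_log hpos).symm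
    _ ≤ _ := Real.exp_le_exp.2 hm.le

/-- **The decay**: if the root `x₀` of `f = 1` satisfies `Λ(x₀) = log g(x₀) ≤ −(1+κ)(s+1)` (`κ > 0`), then
`d_{n+1}^{s+1} r_{n,θ} → 0` along `n = vm` for every `θ ∈ (0,1]` — the quantitative content of
"`g(x₀) < e^{−(s+1)}` ⇒ `d_{n+1}^{s+1} r_{n,1} → 0`" in the proof of Prop. 5.1 (`r_{n,θ} = g(x₀)^{n+o(n)}` by
Lemma 4.1, `d_{n+1} = e^{n+1+o(n)}`). [cite: LaiYu2020, §5 proof of Prop. 5.1] -/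
theorem tendsto_lcm_pow_mul_rT {u v s : ℕ} {B : ℝ} (hu : 1 ≤ u) (hv : 1 ≤ v) (hs : 2 ≤ s)
    (hNs : (2 * u + v) * (zeroSet_finite B).toFinset.card < (s + 1) * v) {x₀ : ℝ} (hx₀ : 0 < x₀)
    (hlt : ∀ x, 0 < x → x < x₀ → 1 < fLY u v s (zeroSet_finite B).toFinset.card x)
    (hgt : ∀ x, x₀ < x → fLY u v s (zeroSet_finite B).toFinset.card x < 1)
    {κ : ℝ} (hκ : 0 < κ) (hLam : Lam u v s B x₀ ≤ -(1 + κ) * ((s : ℝ) + 1))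
    {θ : ℚ} (hθ0 : 0 < θ) (hθ1 : θ ≤ 1) :
    Tendsto (fun m : ℕ => (Nat.lcmUpto (v * m + 1) : ℝ) ^ (s + 1) * rT u v s B m θ) atTop (𝓝 0) := by
  obtain ⟨K, hK, hKb⟩ := rT_le_exp hu hv hs hNs hx₀ hlt hgt
  have hs1 : (0 : ℝ) < (s : ℝ) + 1 := by positivity
  -- `K (1 + log(n+1)) ≤ (κ/4)(s+1) n` eventually
  have hlog : ∀ᶠ m : ℕ in atTop, K * (1 + Real.log (((v * m : ℕ) : ℝ) + 1)) ≤
      κ / 4 * ((s : ℝ) + 1) * ((v * m : ℕ) : ℝ) := by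
    have h := (tendsto_one_add_log_div_mul hv).eventually_lt_const (show (0 : ℝ) < κ / 4 * ((s : ℝ) + 1) / K by
      positivity)
    filter_upwards [h, eventually_ge_atTop 1] with m hm hm1
    have hn : (0 : ℝ) < ((v * m : ℕ) : ℝ) := by
      have : 1 ≤ v * m := by nlinarith
      exact_mod_cast this
    rw [div_lt_iff₀ hn] at hm
    have := mul_le_mul_of_nonneg_left hm.le hK.le
    have e : K * (κ / 4 * ((s : ℝ) + 1) / K * ((v * m : ℕ) : ℝ)) = κ / 4 * ((s : ℝ) + 1) * ((v * m : ℕ) : ℝ) := by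
      field_simp
    linarith
  have hd := eventually_lcmUpto_le_exp hv (show 0 < κ / 2 by linarith)
  -- the majorant
  have hmain : ∀ᶠ m : ℕ in atTop, (Nat.lcmUpto (v * m + 1) : ℝ) ^ (s + 1) * rT u v s B m θ ≤
      Real.exp (((s : ℝ) + 1) * (1 + κ / 2) - ((s : ℝ) + 1) * (κ / 4) * ((v * m : ℕ) : ℝ)) := by
    filter_upwards [hlog, hd, eventually_ge_atTop 1] with m h1 h2 hm
    set n : ℝ := ((v * m : ℕ) : ℝ) with hn
    have hr0 : 0 ≤ rT u v s B m θ := (rT_pos hv hm hs hNs.le hθ0 hθ1).le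
    have hr := hKb m θ hm hθ0 hθ1
    have hdpow : (Nat.lcmUpto (v * m + 1) : ℝ) ^ (s + 1) ≤ Real.exp ((1 + κ / 2) * (n + 1)) ^ (s + 1) :=
      pow_le_pow_left₀ (Nat.cast_nonneg _) h2 _
    calc (Nat.lcmUpto (v * m + 1) : ℝ) ^ (s + 1) * rT u v s B m θ
        ≤ Real.exp ((1 + κ / 2) * (n + 1)) ^ (s + 1) *
          (Real.exp (Lam u v s B x₀) ^ (v * m) * Real.exp (K * (1 + Real.log (n + 1)))) :=
          mul_le_mul hdpow hr hr0 (by positivity)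
      _ = Real.exp (((s : ℝ) + 1) * ((1 + κ / 2) * (n + 1)) + n * Lam u v s B x₀ + K * (1 + Real.log (n + 1))) := by
          rw [← Real.exp_nat_mul, ← Real.exp_nat_mul, ← Real.exp_add, ← Real.exp_add]
          congr 1
          rw [hn]
          push_cast
          ring
      _ ≤ _ := by
          rw [Real.exp_le_exp]
          have hn0 : 0 ≤ n := Nat.cast_nonneg _
          have h3 : n * Lam u v s B x₀ ≤ n * (-(1 + κ) * ((s : ℝ) + 1)) := mul_le_mul_of_nonneg_left hLam hn0
          nlinarith
  have hlim : Tendsto (fun m : ℕ => Real.exp (((s : ℝ) + 1) * (1 + κ / 2) -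
      ((s : ℝ) + 1) * (κ / 4) * ((v * m : ℕ) : ℝ))) atTop (𝓝 0) := by
    refine Real.tendsto_exp_atBot.comp ?_
    have h1 : Tendsto (fun m : ℕ => ((v * m : ℕ) : ℝ)) atTop atTop :=
      tendsto_natCast_atTop_atTop.comp (tendsto_id.const_mul_atTop' hv)
    have h2 := h1.const_mul_atTop (show 0 < ((s : ℝ) + 1) * (κ / 4) by positivity)
    have h3 := tendsto_atBot_add_const_left atTop (((s : ℝ) + 1) * (1 + κ / 2)) (tendsto_neg_atTop_atBot.comp h2)
    refine h3.congr fun m => ?_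
    simp only [Function.comp_apply]
    ring
  refine squeeze_zero' ?_ hmain hlim
  filter_upwards [eventually_ge_atTop 1] with m hm
  exact mul_nonneg (pow_nonneg (Nat.cast_nonneg _) _) (rT_pos hv hm hs hNs.le hθ0 hθ1).le

/-! ### The constants `r₀`, `c₀` -/

/-- `√(4e²+1)² = 4e² + 1`. [cite: LaiYu2020, §5 (r₀ = (√(4e²+1) − 1)/2)] -/
theorem sqrt_sq_aux : Real.sqrt (4 * Real.exp 1 ^ 2 + 1) ^ 2 = 4 * Real.exp 1 ^ 2 + 1 :=
  Real.sq_sqrt (by positivity)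

/-- `r₀ > 0`. [cite: LaiYu2020, §5 (r₀ ≈ 2.26388)] -/
theorem r₀_pos : 0 < r₀ := by
  have h : 1 < Real.sqrt (4 * Real.exp 1 ^ 2 + 1) := by
    rw [Real.lt_sqrt zero_le_one]
    have := Real.exp_pos 1
    nlinarith
  unfold r₀
  linarith

/-- **`r₀(r₀+1) = e²`** (the defining equation of the maximum point). [cite: LaiYu2020, §5 (r₀)] -/
theorem r₀_mul_succ : r₀ * (r₀ + 1) = Real.exp 1 ^ 2 := by
  have h := sqrt_sq_aux
  unfold r₀
  nlinarith [h]

/-- `r₀ < e` (so `1 − log r₀ > 0`). [cite: LaiYu2020, §5 (r₀ ≈ 2.26388)] -/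
theorem r₀_lt_exp : r₀ < Real.exp 1 := by
  have he := Real.exp_pos 1
  have h : Real.sqrt (4 * Real.exp 1 ^ 2 + 1) < 2 * Real.exp 1 + 1 := by
    rw [Real.sqrt_lt' (by linarith)]
    nlinarith
  unfold r₀
  linarith

/-- `log(r₀+1) = 2 − log r₀`. [cite: LaiYu2020, §5 (r₀)] -/
theorem log_r₀_succ : Real.log (r₀ + 1) = 2 - Real.log r₀ := by
  have h := congrArg Real.log r₀_mul_succ
  rw [Real.log_mul r₀_pos.ne' (by linarith [r₀_pos]), Real.log_pow, Real.log_exp] at h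
  push_cast at h
  linarith

/-- **`φ̃(r₀) = (2r₀+1)(1 − log r₀)`** ("with maximal value `1 − log r₀`" of `φ̃(r)/(2r+1)`).
[cite: LaiYu2020, §5 ("with maximal value 1 − log r₀")] -/
theorem phitilde_r₀ : phitilde r₀ = (2 * r₀ + 1) * (1 - Real.log r₀) := by
  rw [phitilde, log_r₀_succ]
  ring

/-- `1 − log r₀ > 0`. [cite: LaiYu2020, §5] -/
theorem one_sub_log_r₀_pos : 0 < 1 - Real.log r₀ := by
  have := Real.log_lt_log r₀_pos r₀_lt_exp
  rw [Real.log_exp] at this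
  linarith

/-- **`c₀² = 4A(1 − log r₀)`**, `A = ζ(2)ζ(3)/ζ(6) = density`. [cite: LaiYu2020, §5 ("c₀ = √((4ζ(2)ζ(3)/ζ(6))(1 − log r₀))")] -/
theorem c₀_sq : c₀ ^ 2 = 4 * density * (1 - Real.log r₀) := by
  rw [c₀, Real.sq_sqrt, density_eq_zetaValue]
  · ring
  · rw [show 4 * zetaValue 2 * zetaValue 3 / zetaValue 6 = 4 * (zetaValue 2 * zetaValue 3 / zetaValue 6) by ring,
      ← density_eq_zetaValue]
    exact mul_nonneg (by linarith [density_pos]) one_sub_log_r₀_pos.le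

/-- `c₀ > 0`. [cite: LaiYu2020, Thm 1.1 (c₀ = 1.1925…)] -/
theorem c₀_pos : 0 < c₀ := by
  have h : 0 < c₀ ^ 2 := by
    rw [c₀_sq]
    have := density_pos
    have := one_sub_log_r₀_pos
    positivity
  have h0 : 0 ≤ c₀ := Real.sqrt_nonneg _
  rcases h0.eq_or_lt with h1 | h1
  · rw [← h1] at h; norm_num at h
  · exact h1

/-! ### Choosing `r` rational near `r₀` -/

/-- Continuity of `r ↦ 4A φ̃(r)/(2r+1)` at `r₀`. [cite: LaiYu2020, §5 ("we can take r (rational number)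
sufficiently close to r₀")] -/
theorem continuousAt_Phi :
    ContinuousAt (fun r : ℝ => 4 * density * phitilde r / (2 * r + 1)) r₀ := by
  have hr := r₀_pos
  have h1 : ContinuousAt (fun r : ℝ => (r + 1) * Real.log (r + 1)) r₀ :=
    (continuousAt_id.add continuousAt_const).mul
      ((Real.continuousAt_log (by linarith)).comp (continuousAt_id.add continuousAt_const))
  have h2 : ContinuousAt (fun r : ℝ => r * Real.log r) r₀ :=
    continuousAt_id.mul (Real.continuousAt_log hr.ne')
  have h3 : ContinuousAt (fun r : ℝ => phitilde r) r₀ := by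
    have := (h1.sub h2).sub (continuousAt_const (y := (1 : ℝ)))
    refine this.congr (Eventually.of_forall fun r => ?_)
    simp [phitilde]
  have h4 : ContinuousAt (fun r : ℝ => 2 * r + 1) r₀ := (continuousAt_const.mul continuousAt_id).add continuousAt_const
  exact (continuousAt_const.mul h3).div h4 (by simp; linarith)

/-- **A rational `r = u/v` (`v` even) near `r₀` with `(2r+1) c₁²/(4A) < φ̃(r)`**, for any `0 ≤ c₁ < c₀`: the
printed "take `r` (rational) sufficiently close to `r₀` and `c` close to `c₀/A` such that
`(A/4)(2r+1)c² + r log r − (r+1) log(r+1) < −1`", here with `c = c₁/A`.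
[cite: LaiYu2020, §5 proof of Thm 1.1] -/
theorem exists_rat_gap {c₁ : ℝ} (hc₁ : 0 ≤ c₁) (hlt : c₁ < c₀) :
    ∃ u v : ℕ, 1 ≤ u ∧ 1 ≤ v ∧ Even v ∧
      (2 * (u : ℝ) + v) / v * density * (c₁ / density) ^ 2 / 4 < phitilde ((u : ℝ) / v) := by
  have hA := density_pos
  have hr := r₀_pos
  -- `Φ(r₀) = c₀² > c₁²`
  have hΦ0 : c₁ ^ 2 < 4 * density * phitilde r₀ / (2 * r₀ + 1) := by
    rw [phitilde_r₀, show 4 * density * ((2 * r₀ + 1) * (1 - Real.log r₀)) / (2 * r₀ + 1) =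
      4 * density * (1 - Real.log r₀) by field_simp, ← c₀_sq]
    exact pow_lt_pow_left₀ hlt hc₁ two_ne_zero
  have hev : ∀ᶠ r : ℝ in 𝓝 r₀, c₁ ^ 2 < 4 * density * phitilde r / (2 * r + 1) :=
    continuousAt_Phi.eventually (lt_mem_nhds hΦ0)
  obtain ⟨η, hη, hball⟩ := Metric.eventually_nhds_iff.1 hev
  obtain ⟨q, hq1, hq2⟩ := exists_rat_btwn (show r₀ < r₀ + η by linarith)
  have hq0 : (0 : ℝ) < q := hr.trans hq1
  have hq0' : 0 < q := by exact_mod_cast hq0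
  have hΦq : c₁ ^ 2 < 4 * density * phitilde q / (2 * q + 1) := by
    apply hball
    rw [Real.dist_eq, abs_lt]
    constructor <;> linarith
  -- `u = 2 num q`, `v = 2 den q`
  have hnum : 0 < q.num := Rat.num_pos.2 hq0'
  refine ⟨2 * q.num.toNat, 2 * q.den, by omega, by have := q.den_pos; omega, even_two_mul _, ?_⟩
  have huv : ((2 * q.num.toNat : ℕ) : ℝ) / ((2 * q.den : ℕ) : ℝ) = (q : ℝ) := by
    have h1 : ((q.num.toNat : ℕ) : ℤ) = q.num := Int.toNat_of_nonneg hnum.le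
    have h2 : (q : ℝ) = (q.num : ℝ) / (q.den : ℝ) := by exact_mod_cast (Rat.num_div_den q).symm
    have hd : (0 : ℝ) < q.den := by exact_mod_cast q.den_pos
    rw [h2]
    push_cast
    rw [show ((q.num.toNat : ℕ) : ℝ) = (q.num : ℝ) by exact_mod_cast h1]
    field_simp
  have hρ : (2 * ((2 * q.num.toNat : ℕ) : ℝ) + ((2 * q.den : ℕ) : ℝ)) / ((2 * q.den : ℕ) : ℝ) = 2 * (q : ℝ) + 1 := by
    have hd : (0 : ℝ) < ((2 * q.den : ℕ) : ℝ) := by have := q.den_pos; positivity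
    rw [← huv]
    field_simp
  rw [huv, hρ]
  have h2q : 0 < 2 * (q : ℝ) + 1 := by linarith
  rw [lt_div_iff₀ h2q] at hΦq
  have e : (2 * (q : ℝ) + 1) * density * (c₁ / density) ^ 2 / 4 = c₁ ^ 2 * (2 * (q : ℝ) + 1) / (4 * density) := by
    field_simp
  rw [e, div_lt_iff₀ (by positivity)]
  linarith

/-! ### The assembly for an admissible pair `(r, c)` -/

/-- There are at least `(s−1)/2` odd integers in `[3, s]`. [cite: LaiYu2020, §5 proof of Thm 1.1 ("|Ψ_B| = o(s)")] -/
theorem half_le_card_oddIcc (s : ℕ) : (s - 1) / 2 ≤ ((Icc 3 s).filter Odd).card := by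
  classical
  have hsub : (Icc 1 ((s - 1) / 2)).image (fun k => 2 * k + 1) ⊆ (Icc 3 s).filter Odd := by
    intro x hx
    obtain ⟨k, hk, rfl⟩ := mem_image.1 hx
    have hk' := mem_Icc.1 hk
    refine mem_filter.2 ⟨mem_Icc.2 ⟨by omega, by omega⟩, odd_two_mul_add_one k⟩
  calc (s - 1) / 2 = ((Icc 1 ((s - 1) / 2))).card := by simp
    _ = ((Icc 1 ((s - 1) / 2)).image (fun k => 2 * k + 1)).card :=
        (card_image_of_injective _ fun a b hab => by simpa using hab).symm
    _ ≤ _ := card_le_card hsub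

/-- `|Ψ_B| ≤ |𝓕_B|` (`b ↦ 1/b` is injective `Ψ_B → 𝓕_B`). [cite: LaiYu2020, Def. 2.1] -/
theorem card_denominatorSet_le_card_zeroSet (B : ℝ) :
    (denominatorSet_finite B).toFinset.card ≤ (zeroSet_finite B).toFinset.card := by
  classical
  refine Finset.card_le_card_of_injOn (fun b : ℕ => (1 : ℚ) / b) (fun b hb => ?_) (fun b₁ hb₁ b₂ hb₂ h => ?_)
  · have hb' := (denominatorSet_finite B).mem_toFinset.1 hb
    rw [Set.Finite.coe_toFinset]
    have := div_mem_zeroSet (k := 1) hb' le_rfl hb'.1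
    simpa using this
  · have h1 := ((denominatorSet_finite B).mem_toFinset.1 hb₁).1
    have h2 := ((denominatorSet_finite B).mem_toFinset.1 hb₂).1
    have h1' : (b₁ : ℚ) ≠ 0 := by exact_mod_cast h1.ne'
    have h2' : (b₂ : ℚ) ≠ 0 := by exact_mod_cast h2.ne'
    simp only [one_div, inv_inj] at h
    exact_mod_cast h

/-- **The assembly** (Prop. 4.2 + Lemma 4.1 + Prop. 5.1): for `r = u/v` (`v` even) and `c > 0` with
`(2r+1)Ac²/4 < φ̃(r)`, for all large odd `s` at least `|Ψ_{B(s)}|` of `ζ(3), …, ζ(s)` are irrational,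
`B(s) = c√s/√(log s)`. [cite: LaiYu2020, §5 proof of Thm 1.1] -/
theorem eventually_card_le_of_gap {u v : ℕ} (hu : 1 ≤ u) (hv : 1 ≤ v) (hve : Even v) {c : ℝ} (hc : 0 < c)
    (hgap : (2 * (u : ℝ) + v) / v * density * c ^ 2 / 4 < phitilde ((u : ℝ) / v)) :
    ∀ᶠ s : ℕ in atTop, Odd s → ((denominatorSet_finite (Bfun c s)).toFinset.card : ℝ) ≤
      (({i : ℕ | Odd i ∧ 3 ≤ i ∧ i ≤ s ∧ Irrational (zetaValue i)}).ncard : ℝ) := by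
  have hv0 : (0 : ℝ) < v := by exact_mod_cast hv
  have hu0 : (0 : ℝ) < u := by exact_mod_cast hu
  obtain ⟨κ, hκ, hLam⟩ := eventually_Lam_le hu hv hc hgap
  have hB1 : ∀ᶠ s : ℕ in atTop, 1 ≤ Bfun c s := (tendsto_Bfun_atTop hc).eventually_ge_atTop _
  have hN := eventually_card_zeroSet_Bfun_le hc (show (0 : ℝ) < 1 / (4 * ((u : ℝ) + v)) by positivity)
  filter_upwards [hLam, hB1, hN, eventually_ge_atTop 3] with s hLam' hB hN' hs3 hsodd
  set B := Bfun c s with hBdef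
  set N := (zeroSet_finite B).toFinset.card with hNdef
  have hs1 : (0 : ℝ) < (s : ℝ) + 1 := by positivity
  -- the arithmetic side conditions
  have hNreal : 4 * ((u : ℝ) + v) * N ≤ (s : ℝ) + 1 := by
    have := mul_le_mul_of_nonneg_left hN' (show 0 ≤ 4 * ((u : ℝ) + v) by positivity)
    have e : 4 * ((u : ℝ) + v) * (1 / (4 * ((u : ℝ) + v)) * ((s : ℝ) + 1)) = (s : ℝ) + 1 := by
      field_simp
    linarith
  have hNnat : 4 * (u + v) * N ≤ s + 1 := by exact_mod_cast hNreal
  have hNs2 : (2 * u + v) * N + 2 ≤ (s + 1) * v := by nlinarith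
  have hNs : (2 * u + v) * N < (s + 1) * v := by omega
  have hNa : (2 * u + 2 * v) * N ≤ (s + 1) * v := by nlinarith
  have hN1 : 1 ≤ N := card_pos.2 ⟨1, (zeroSet_finite B).mem_toFinset.2 (one_mem_zeroSet hB)⟩
  have hroom : (denominatorSet_finite B).toFinset.card ≤ ((Icc 3 s).filter Odd).card + 1 := by
    have h1 := card_denominatorSet_le_card_zeroSet B
    have h2 := half_le_card_oddIcc s
    have h3 : 4 * N ≤ 4 * (u + v) * N := Nat.mul_le_mul_right _ (by omega)
    rw [← hNdef] at h1
    omega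
  -- the root `x₀` of `f = 1` and its location `x₀ ≤ r(r+1)`
  obtain ⟨x₀, hx₀, hf1, hlt, hgt, hx₀lt⟩ := exists_root (s := s) hu hv hN1 hNs
  have hxR : x₀ ≤ ((u : ℝ) / v) * ((u : ℝ) / v + 1) := by
    have hNa' : (2 * (u : ℝ) + 2 * v) * N ≤ ((s : ℝ) + 1) * v := by exact_mod_cast hNa
    have ha : (N : ℝ) ≤ (s : ℝ) + 1 - (2 * (u : ℝ) + v) / v * N := by
      have e : (2 * (u : ℝ) + v) / v * N + N = (2 * (u : ℝ) + 2 * v) * N / v := by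
        field_simp
        ring
      have : (2 * (u : ℝ) + v) / v * N + N ≤ (s : ℝ) + 1 := by
        rw [e, div_le_iff₀ hv0]
        exact hNa'
      linarith
    have hN0 : (1 : ℝ) ≤ N := by exact_mod_cast hN1
    have ha0 : 0 < (s : ℝ) + 1 - (2 * (u : ℝ) + v) / v * N := by linarith
    have hR0 : 0 ≤ ((u : ℝ) / v) * ((u : ℝ) / v + 1) := by positivity
    have : ((u : ℝ) / v) * ((u : ℝ) / v + 1) * N / ((s : ℝ) + 1 - (2 * (u : ℝ) + v) / v * N) ≤
        ((u : ℝ) / v) * ((u : ℝ) / v + 1) := by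
      rw [div_le_iff₀ ha0]
      exact mul_le_mul_of_nonneg_left ha hR0
    linarith
  have hLx := hLam' x₀ hx₀.le hxR
  -- the two analytic inputs of the elimination step
  have hdecay := tendsto_lcm_pow_mul_rT hu hv (by omega) hNs hx₀ hlt hgt hκ hLx one_pos le_rfl
  have hratio : ∀ θ ∈ zeroSet B, Tendsto (fun m : ℕ => rT u v s B m 1 / rT u v s B m θ) atTop (𝓝 1) :=
    fun θ hθ => tendsto_ratio hu hv (by omega) hNs hx₀ hf1 hlt hgt ((mem_zeroSet).1 hθ).1 ((mem_zeroSet).1 hθ).2.1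
  exact_mod_cast card_denominatorSet_le_card_irrational_of_decay hu hv hve hB hsodd hs3 hNs2 hdecay hratio hroom

/-! ### Theorem 1.1 -/

/-- **Lai–Yu 2020, Theorem 1.1 (PROVED)** — discharge of the named fact `theorem11`: for every `ε > 0` and
all large odd `s`, at least `(c₀ − ε)√s/√(log s)` of `ζ(3), ζ(5), …, ζ(s)` are irrational,
`c₀ = √((4ζ(2)ζ(3)/ζ(6))(1 − log r₀)) = 1.1925…`. [cite: LaiYu2020, Thm 1.1 and §5 (proof of Theorem 1.1)] -/
theorem theorem11_holds : theorem11 := by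
  intro ε hε
  have hA := density_pos
  -- the trivial case `ε ≥ c₀`
  by_cases hεc : c₀ ≤ ε
  · refine ⟨0, fun s _ _ => ?_⟩
    have h1 : (c₀ - ε) * Real.sqrt s / Real.sqrt (Real.log s) ≤ 0 :=
      div_nonpos_of_nonpos_of_nonneg (mul_nonpos_of_nonpos_of_nonneg (by linarith) (Real.sqrt_nonneg _))
        (Real.sqrt_nonneg _)
    exact h1.trans (Nat.cast_nonneg _)
  push Not at hεc
  -- parameters: `c₁ = c₀ − ε/2 = A c`, `r = u/v` near `r₀`
  set c₁ : ℝ := c₀ - ε / 2 with hc₁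
  have hc₁0 : 0 < c₁ := by rw [hc₁]; linarith
  obtain ⟨u, v, hu, hv, hve, hgap⟩ := exists_rat_gap hc₁0.le (show c₁ < c₀ by rw [hc₁]; linarith)
  set c : ℝ := c₁ / density with hcdef
  have hc : 0 < c := div_pos hc₁0 hA
  have hmain := eventually_card_le_of_gap hu hv hve hc hgap
  -- `|Ψ_B| ≥ (A − ε₁) B` for large `B` (Prop. 2.2 (1)), `ε₁ = εA/(2c₀)`
  set ε₁ : ℝ := ε * density / (2 * c₀) with hε₁
  have hε₁0 : 0 < ε₁ := by rw [hε₁]; exact div_pos (mul_pos hε hA) (by linarith [c₀_pos])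
  have hcount : ∀ᶠ B : ℝ in atTop, (density - ε₁) * B ≤ ((denominatorSet B).ncard : ℝ) := by
    have h := card_denominatorSet_holds
    unfold card_denominatorSet at h
    rw [← density_eq_zetaValue] at h
    filter_upwards [h.eventually_const_lt (show density - ε₁ < density by linarith), eventually_gt_atTop 0]
      with B hB hB0
    rw [lt_div_iff₀ hB0] at hB
    exact hB.le
  have hcount' := (tendsto_Bfun_atTop hc).eventually hcount
  obtain ⟨s₀, hs₀⟩ := eventually_atTop.1 (hmain.and hcount')
  refine ⟨s₀, fun s hs hsodd => ?_⟩
  obtain ⟨h1, h2⟩ := hs₀ s hs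
  have h1' := h1 hsodd
  rw [Set.ncard_eq_toFinset_card _ (denominatorSet_finite (Bfun c s))] at h2
  -- `(c₀ − ε) √s/√log s ≤ (A − ε₁) c √s/√log s`
  have hcoef : c₀ - ε ≤ (density - ε₁) * c := by
    have hc0 := c₀_pos
    have e : (density - ε₁) * c = c₀ - ε + ε ^ 2 / (4 * c₀) := by
      rw [hcdef, hε₁, hc₁]
      field_simp
      ring
    have : 0 ≤ ε ^ 2 / (4 * c₀) := by positivity
    linarith
  have hsq : 0 ≤ Real.sqrt s / Real.sqrt (Real.log s) := by positivity
  calc (c₀ - ε) * Real.sqrt s / Real.sqrt (Real.log s)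
      = (c₀ - ε) * (Real.sqrt s / Real.sqrt (Real.log s)) := by ring
    _ ≤ (density - ε₁) * c * (Real.sqrt s / Real.sqrt (Real.log s)) := mul_le_mul_of_nonneg_right hcoef hsq
    _ = (density - ε₁) * Bfun c s := by rw [Bfun]; ring
    _ ≤ ((denominatorSet_finite (Bfun c s)).toFinset.card : ℝ) := h2
    _ ≤ _ := h1'

end Lemma41

/-- **Lai–Yu 2020, Theorem 1.1 (PROVED)**: `theorem11` holds — for any `ε > 0` and all sufficiently large odd
`s`, at least `(c₀ − ε) s^{1/2}/(log s)^{1/2}` of the numbers `ζ(3), ζ(5), …, ζ(s)` are irrational, where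
`c₀ = √((4ζ(2)ζ(3)/ζ(6))(1 − log((√(4e²+1) − 1)/2))) = 1.192507…`. Users of the named fact
`(h : theorem11)` are fed `theorem11_holds`. [cite: LaiYu2020, Thm 1.1] -/
theorem theorem11_holds : theorem11 := Lemma41.theorem11_holds

end Literature.NumberTheory.Irrationality.LaiYu2020
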